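import Mathlib
import Literature.MathematicalPhysics.QuantumFieldTheory.QCDOS
import Literature.Barriers.QuantumFields.WilsonDeterminantSign

/-!
# Crux-ideate sketches — stmt-QuantumFields-9150 `WilsonMobilityGap.MobilityGap`, round 1, ideator 3

First lemmas (statements that elaborate; some proved) for the two crux idea cards

* `one-sea-power-buys-s-one`  — the phase-quenched FIRST absolute moment of the flavour-`f`
  propagator is the natural integrability threshold (Jacobi: `|det D|·|D⁻¹ᵢⱼ| = |adj D ⱼᵢ|`),
  Jensen returns every `s < 1`; clause (ii) should be proved at `s = 1`.
* `shoot-the-window-ids` — define `m_crit(k)` as the threshold of the phase-quenched WINDOW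
  DENSITY OF STATES of `Γ₅ D_W` at the realised bare mass; Weyl's inequality (`‖∂H/∂m₀‖ = ‖Γ₅‖ = 1`)
  transports window counts across the crux's tuples; (ii) reduces to eigenfunction-correlator
  localisation of a θ-dilute window family plus a deterministic bulk.

Nothing here is a route item; nothing is filed through the gate.
-/

noncomputable section

open scoped BigOperators Matrix ComplexConjugate
open MeasureTheory Filter Matrix
open Literature.MathematicalPhysics.QuantumFieldTheory Literature.MathematicalPhysics.QuantumLattice
  Literature.Probability.LatticeModels

namespace Summit.QuantumFields.QCD.Cruxes.MobilityGap.Ideator3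

/-! ## Part A — the `s`-parametrised UPPER clause of the crux and the Jensen descent -/

/-- The phase-quenched `s`-moment of the entrywise `ℓ¹` size of the flavour-`f` propagator block
between `0` and `v` on the torus of side `2S+1` at scheme step `k` — literally the ratio of
integrals of clause (ii) of `MobilityGap`, with the exponent `s` made a parameter. -/
def upperMoment (Nf : ℕ) (reg : QCDRegularisation Nf) (m : Fin Nf → ℝ) (s : ℝ) (k S : ℕ)
    (f : Fin Nf) (v : Site 4) : ℝ :=
  (∫ U : GaugeConfig 4 (2 * S + 1) (Matrix.specialUnitaryGroup (Fin 3) ℂ),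
      ‖(diracMatrix U fun fl => reg.mcrit k + reg.a k * m fl / reg.Zm k).det‖ *
        (∑ a : Fin 3, ∑ i : Fin 4, ∑ b : Fin 3, ∑ j : Fin 4,
          ‖(diracMatrix U fun fl => reg.mcrit k + reg.a k * m fl / reg.Zm k)⁻¹
            (quarkEquiv (f, (Torus.proj (2 * S + 1) 0, a, i)))
            (quarkEquiv (f, (Torus.proj (2 * S + 1) v, b, j)))‖) ^ s
      ∂(wilsonMeasure (fundamentalRep (Fin 3)) (reg.β k))) /
    (∫ U : GaugeConfig 4 (2 * S + 1) (Matrix.specialUnitaryGroup (Fin 3) ℂ),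
      ‖(diracMatrix U fun fl => reg.mcrit k + reg.a k * m fl / reg.Zm k).det‖
      ∂(wilsonMeasure (fundamentalRep (Fin 3)) (reg.β k)))

/-- Clause (ii) of `MobilityGap` at a FIXED exponent `s` (physical-rate decay of the `s`-moment,
uniformly in the volume `S ≥ L_k`, eventually in `k`). Clause (ii) itself is
`∃ s ∈ (0,1), UpperDecayAt Nf reg m s`. -/
def UpperDecayAt (Nf : ℕ) (reg : QCDRegularisation Nf) (m : Fin Nf → ℝ) (s : ℝ) : Prop :=
  ∃ δ C : ℝ, 0 < δ ∧ ∀ᶠ k in atTop, ∀ S : ℕ, reg.L k ≤ S → ∀ (f : Fin Nf) (v : Site 4),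
    v ∈ box 4 S → upperMoment Nf reg m s k S f v ≤ C * Real.exp (-(δ * (reg.a k * ‖v‖)))

/-- **First lemma of card `one-sea-power-buys-s-one` (Jensen descent).** The first-moment form of
clause (ii) implies clause (ii) for every `s ∈ (0,1)` with constants `(sδ, C^s)`: the phase-quenched
law is a probability measure (the weight `‖det‖ ≥ 0` has positive Wilson-measure integral) and
`t ↦ t^s` is concave on `[0,∞)`. Stated, not proved here (Mathlib: `ConcaveOn.le_map_integral`). -/
def JensenDescent : Prop :=
  ∀ (Nf : ℕ) (reg : QCDRegularisation Nf) (m : Fin Nf → ℝ),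
    UpperDecayAt Nf reg m 1 → ∀ s : ℝ, 0 < s → s < 1 → UpperDecayAt Nf reg m s

/-- **Jacobi's identity behind the card (proved):** for an invertible complex matrix the weight of
the phase-quenched law cancels the pole of the propagator EXACTLY ONCE —
`‖det D‖ · ‖(D⁻¹) i j‖ = ‖(adj D) i j‖`, a polynomial (hence bounded on compacts) function of the
entries. So `|det D_f| · Σ|G_f(0,v)|` is pole-free: the first absolute moment of a flavour's own
propagator is finite under ONE power of that flavour's `|det|`, for every tuple and every `N_f`. -/
theorem norm_det_mul_norm_inv_apply {n : Type*} [Fintype n] [DecidableEq n]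
    (D : Matrix n n ℂ) (hD : IsUnit D.det) (i j : n) :
    ‖D.det‖ * ‖D⁻¹ i j‖ = ‖D.adjugate i j‖ := by
  have h : D⁻¹ = (D.det)⁻¹ • D.adjugate := by
    rw [Matrix.inv_def, Ring.inverse_eq_inv']
  have hne : D.det ≠ 0 := hD.ne_zero
  rw [h, Matrix.smul_apply, smul_eq_mul, norm_mul, norm_inv, ← mul_assoc,
    mul_inv_cancel₀ (norm_ne_zero_iff.mpr hne), one_mul]

/-! ## Part B — shooting the window density of states -/

section Window

variable {L : ℕ} [NeZero L]

/-- Number of eigenvalues of the Hermitian Wilson–Dirac operator `Γ₅ D_W(U, m₀, r = 1)`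
(fundamental `SU(3)`, torus of side `L`) in the open window `(−g, g)` — the same counting
expression as the shared support item `WegnerEstimate`. -/
def windowCount (U : GaugeConfig 4 L (Matrix.specialUnitaryGroup (Fin 3) ℂ)) (m₀ g : ℝ) : ℕ :=
  Multiset.countP (fun z : ℂ => |z.re| < g)
    (spinorLift gammaFive * wilsonDirac (fundamentalRep (Fin 3)) U m₀ 1).charpoly.roots

end Window

/-- The phase-quenched WINDOW DENSITY OF STATES per quark degree of freedom of flavour `f` at bare
masses `mq` on the torus of side `2S+1` at inverse coupling `β`: the normalised expectation of
`windowCount` for `Γ₅ D_W(U, mq f, 1)` under the Wilson measure reweighted by `‖det diracMatrix‖`,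
divided by `12 (2S+1)⁴`. This is the LINEAR SPECTRAL STATISTIC the card shoots on. -/
def windowIDS (Nf : ℕ) (β : ℝ) (S : ℕ) (mq : Fin Nf → ℝ) (f : Fin Nf) (g : ℝ) : ℝ :=
  (∫ U : GaugeConfig 4 (2 * S + 1) (Matrix.specialUnitaryGroup (Fin 3) ℂ),
      ‖(diracMatrix U mq).det‖ * (windowCount U (mq f) g : ℝ)
      ∂(wilsonMeasure (fundamentalRep (Fin 3)) β)) /
    ((12 * (2 * (S : ℝ) + 1) ^ 4) *
      ∫ U : GaugeConfig 4 (2 * S + 1) (Matrix.specialUnitaryGroup (Fin 3) ℂ),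
        ‖(diracMatrix U mq).det‖ ∂(wilsonMeasure (fundamentalRep (Fin 3)) β))

/-- The up-set of GOOD FLOORS at step data `(β, Lk, a, u₀, η)`: bare-mass floors `m'` such that for
EVERY tuple of bare masses componentwise `≥ m'`, every volume `S ≥ Lk` and every flavour, the
window density of states in the window `|λ| < a·u₀` is at most `η` (the card takes `η = θ a⁴`).
Raising the floor shrinks the family of tuples, so this is an up-set by construction. -/
def GoodFloor (Nf : ℕ) (β : ℝ) (Lk : ℕ) (a u₀ η : ℝ) : Set ℝ :=
  {m' | ∀ (mq : Fin Nf → ℝ), (∀ f, m' ≤ mq f) → ∀ S : ℕ, Lk ≤ S → ∀ f : Fin Nf,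
    windowIDS Nf β S mq f (a * u₀) ≤ η}

/-- `GoodFloor` is an up-set (pure order). -/
theorem goodFloor_upward (Nf : ℕ) (β : ℝ) (Lk : ℕ) (a u₀ η : ℝ) {m' m'' : ℝ}
    (h : m' ∈ GoodFloor Nf β Lk a u₀ η) (hle : m' ≤ m'') : m'' ∈ GoodFloor Nf β Lk a u₀ η :=
  fun mq hmq S hS f => h mq (fun g => le_trans hle (hmq g)) S hS f

/-- **Threshold lemma (proved, pure order):** if the good floors are bounded below and non-empty,
every bare mass strictly above `m_shot := sInf GoodFloor` is a good floor; in particular every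
realised trajectory mass `m_shot + a m_f / Z_m` with `m_f > 0` inherits the window diluteness BY
DEFINITION — the Lifshitz-tail (initial-scale) input of the localisation problem costs no physics. -/
theorem mem_goodFloor_of_sInf_lt (Nf : ℕ) (β : ℝ) (Lk : ℕ) (a u₀ η : ℝ)
    (hbdd : BddBelow (GoodFloor Nf β Lk a u₀ η)) (hne : (GoodFloor Nf β Lk a u₀ η).Nonempty)
    {x : ℝ} (hx : sInf (GoodFloor Nf β Lk a u₀ η) < x) : x ∈ GoodFloor Nf β Lk a u₀ η := by
  obtain ⟨y, hy, hyx⟩ := (csInf_lt_iff hbdd hne).1 hx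
  exact goodFloor_upward Nf β Lk a u₀ η hy hyx.le

/-- **Weyl transport of window counts (first lemma of card `shoot-the-window-ids`, stated):** for
Hermitian matrices `A`, `B` with `B` of quadratic-form size `≤ ε`, every eigenvalue moves by at most
`ε`, so the count of eigenvalues of `A + B` in `(−E, E)` is at least the count of eigenvalues of `A`
in `(−(E−ε), E−ε)`. Applied to `A = Γ₅D_W(m₀)`, `B = (m₀' − m₀)Γ₅` (`‖Γ₅‖ = 1`): window statistics
of the Hermitian Wilson–Dirac kernel transport between the crux's tuples at exactly the crux's
bare-mass resolution `a_k|m_f − m_g|/Z_m(k)`. (Lidskii/Weyl; Mathlib has the spectral theorem but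
not yet the min–max count comparison, hence stated.) -/
def WeylWindowTransport : Prop :=
  ∀ (n : Type) [Fintype n] [DecidableEq n] (A B : Matrix n n ℂ) (hA : A.IsHermitian)
    (hAB : (A + B).IsHermitian) (ε E : ℝ), 0 ≤ ε →
    (∀ v : n → ℂ, ‖star v ⬝ᵥ (B *ᵥ v)‖ ≤ ε * ∑ i, ‖v i‖ ^ 2) →
    (Finset.univ.filter fun i => |hA.eigenvalues i| < E - ε).card ≤
      (Finset.univ.filter fun i => |hAB.eigenvalues i| < E).card

/-- **The Γ₅-square identity (proved):** for a `Γ`-Hermitian matrix `D` (`Γ² = 1`, `Dᴴ = Γ D Γ` —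
the Wilson–Dirac operator with `Γ = spinorLift gammaFive`), raising the bare mass by `ε` changes the
SQUARE of the Hermitian kernel by a positive constant plus twice the Hermitian part of `D`:
`(Γ(D + ε))² = (ΓD)² + ε(D + Dᴴ) + ε²`. Since `D_W + D_Wᴴ = 2(m₀ + W_U)` with `W_U = −½Δ_U ≥ 0`
the covariant Wilson Laplacian, mass-raising is monotone (adds `≥ ε²`) on the spectral sector
`W_U ≥ |m₀|`; window states at heavier tuples descend from the Laplacian-smooth sector of the
kernel at the lightest tuple (companion to the Weyl transport, used in the card's remark (W2)). -/
theorem gamma_sq_mass_shift {n : Type*} [Fintype n] [DecidableEq n]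
    (Γ D : Matrix n n ℂ) (hΓ : Γ * Γ = 1) (hD : Dᴴ = Γ * D * Γ) (ε : ℂ) :
    (Γ * (D + ε • (1 : Matrix n n ℂ))) ^ 2 =
      (Γ * D) ^ 2 + ε • (D + Dᴴ) + (ε ^ 2) • (1 : Matrix n n ℂ) := by
  rw [hD]
  simp only [sq, Matrix.mul_add, Matrix.add_mul, Matrix.mul_smul, Matrix.smul_mul, Matrix.mul_one,
    smul_add]
  rw [← Matrix.mul_assoc Γ Γ D, hΓ, Matrix.one_mul, smul_smul]
  abel

/-! ## Part C — the window eigenfunction correlator (the residual object of card 2) -/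

section Eigencorrelator

open Literature.Barriers.QuantumFields.WilsonDeterminant

variable {L : ℕ} [NeZero L]

/-- The WINDOW EIGENFUNCTION CORRELATOR of `H = Γ₅ D_W(U, m₀, 1)` (fundamental `SU(3)`, side `L`)
between sites `x` and `y` for the window `|λ| < g`: `Σ_{i : |λᵢ| < g} ‖ψᵢ(x)‖ · ‖ψᵢ(y)‖`, with
`ψᵢ(x) ∈ ℂ³ ⊗ ℂ⁴` the colour–spin block of the `i`-th orthonormal eigenvector at site `x` (block
size = `ℓ²` norm of the 12 components). Deterministic bulk (smooth functional calculus of `H` off the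
window) plus the phase-quenched decay of THIS quantity is what the card reduces clause (ii) to. -/
def windowEigencorrelator (U : GaugeConfig 4 L (Matrix.specialUnitaryGroup (Fin 3) ℂ))
    (m₀ g : ℝ) (x y : TorusSite 4 L) : ℝ :=
  let hH := isHermitian_hermitianWilsonDirac (fundamentalRep (Fin 3))
    (fundamentalRep_mem_unitaryGroup (n := Fin 3)) U m₀ 1
  ∑ i : Idx L 3, if |hH.eigenvalues i| < g then
    Real.sqrt (∑ a : Fin 3, ∑ α : Fin 4, ‖(hH.eigenvectorBasis i : Idx L 3 → ℂ) (x, a, α)‖ ^ 2) *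
      Real.sqrt (∑ b : Fin 3, ∑ γ : Fin 4, ‖(hH.eigenvectorBasis i : Idx L 3 → ℂ) (y, b, γ)‖ ^ 2)
  else 0

end Eigencorrelator

end Summit.QuantumFields.QCD.Cruxes.MobilityGap.Ideator3
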